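import Mathlib
import HarnessLib

/-!
# RootDecompChiralSerrin — crux S `OneSectorSerrinExtends` (stmt-NavierStokesRegularity-30121), stub `stub_gronwallL1`

Registered stub (writer g10 first-prover skeleton, 2026-08-30; lens-1 g6 «CHIRAL SERRIN LADDER», the Grönwall step of S),
PROVED here verbatim: a continuous nonnegative `H` on `[0, T)` with `H(t) ≤ H(0) + K ∫₀ᵗ g H` for an `L¹` weight
`g : ℝ → ℝ≥0∞` (`∫_{(0,T)} g < ∞`, lower Lebesgue integrals, `toReal` junk-tolerant) is BOUNDED on `[0, T)`.

Proof (no differentiation, the weight is only measurable): absolute continuity of `s ↦ ∫_s g`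
(`exists_pos_setLIntegral_lt_of_measure_lt`) gives a mesh `w = T/N` with `K ∫_J g ≤ 1/2` on every subinterval
`J ⊆ (0,T)` of length `≤ w`; induction over the pieces `[i w, (i+1) w]` with the sup trick: if `H ≤ M` up to `i w`,
then on `[i w, t]` the maximum `m` of `H` obeys `m ≤ H(0) + K M ∫g + m/2`, whence `m ≤ 2 (H(0) + K M ∫ g)`.
Elementary; no PDE. Decoration toward S; Navier–Stokes regularity is NOT proved by anything here (rung 0).
-/

-- the summit and its single sub-problem share the name (CONVENTIONS §1), as in every Theorems file
set_option linter.dupNamespace false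

open MeasureTheory Set Filter Topology
open scoped ENNReal

namespace Summit.NavierStokesRegularity.NavierStokesRegularity.Theorems.OneSectorSerrinExtends

/-- **Registered stub `stub_gronwallL1`** of crux `OneSectorSerrinExtends` (stmt-NavierStokesRegularity-30121), verbatim:
Grönwall boundedness with an `L¹` (merely measurable) weight. [folklore] -/
theorem stub_gronwallL1 : ∀ (T K : ℝ) (H : ℝ → ℝ) (g : ℝ → ℝ≥0∞), 0 < T → 0 ≤ K → Measurable g → (∫⁻ t in Set.Ioo 0 T, g t) < ⊤ → ContinuousOn H (Set.Ico 0 T) → (∀ t ∈ Set.Ico 0 T, 0 ≤ H t) → (∀ t ∈ Set.Ico 0 T, H t ≤ H 0 + K * (∫⁻ s in Set.Ioo 0 t, g s * ENNReal.ofReal (H s)).toReal) → ∃ M : ℝ, ∀ t ∈ Set.Ico 0 T, H t ≤ M := by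
  intro T K H g hT hK hg hgint hcont hH0 hle
  -- total mass of the weight
  set L : ℝ≥0∞ := ∫⁻ t in Ioo 0 T, g t with hL
  have hLtop : L ≠ ⊤ := hgint.ne
  -- smallness scale `ε` with `K ε ≤ 1/2`
  set ε : ℝ≥0∞ := ENNReal.ofReal (1 / (2 * (K + 1))) with hε
  have hεpos : ε ≠ 0 := (ENNReal.ofReal_pos.2 (by positivity)).ne'
  have hεtop : ε ≠ ⊤ := ENNReal.ofReal_ne_top
  have hKε : K * ε.toReal ≤ 1 / 2 := by
    rw [hε, ENNReal.toReal_ofReal (by positivity), mul_one_div, div_le_iff₀ (by positivity)]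
    linarith
  -- absolute continuity of `s ↦ ∫_s g` on `(0, T)`
  have hgint' : ∫⁻ t, g t ∂(volume.restrict (Ioo 0 T)) ≠ ⊤ := hgint.ne
  obtain ⟨δ, hδ, hδint⟩ := exists_pos_setLIntegral_lt_of_measure_lt hgint' hεpos
  obtain ⟨r, -, hr0, hrδ⟩ := ENNReal.lt_iff_exists_real_btwn.1 hδ
  have hr : 0 < r := ENNReal.ofReal_pos.1 hr0
  -- the mesh `w = T / N < r`
  obtain ⟨N, hN⟩ := exists_nat_gt (T / r)
  have hNpos : 0 < (N : ℝ) := lt_trans (div_pos hT hr) hN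
  set w : ℝ := T / N with hw
  have hwpos : 0 < w := div_pos hT hNpos
  have hwr : w < r := by
    rw [hw, div_lt_iff₀ hNpos]
    have := (div_lt_iff₀ hr).1 hN
    linarith
  -- short subintervals of `(0, T)` carry little weight
  have hshort : ∀ a b : ℝ, 0 ≤ a → b ≤ T → b - a ≤ w → ∫⁻ s in Ioo a b, g s < ε := by
    intro a b ha hb hab
    have hsub : Ioo a b ⊆ Ioo 0 T := Ioo_subset_Ioo ha hb
    have h1 : (volume.restrict (Ioo 0 T)) (Ioo a b) < δ := by
      rw [Measure.restrict_apply measurableSet_Ioo, inter_eq_self_of_subset_left hsub, Real.volume_Ioo]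
      calc ENNReal.ofReal (b - a) ≤ ENNReal.ofReal r := ENNReal.ofReal_le_ofReal (by linarith)
        _ < δ := hrδ
    have h2 := hδint (Ioo a b) h1
    rwa [Measure.restrict_restrict measurableSet_Ioo, inter_eq_self_of_subset_left hsub] at h2
  -- induction over the pieces `[0, i w]`
  have step : ∀ i : ℕ, ∃ M : ℝ, 0 ≤ M ∧ ∀ t ∈ Ico 0 T, t ≤ i * w → H t ≤ M := by
    intro i
    induction i with
    | zero =>
      refine ⟨H 0, hH0 0 ⟨le_rfl, hT⟩, fun t ht hti => ?_⟩
      have h0 : t = 0 := le_antisymm (by simpa using hti) ht.1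
      rw [h0]
    | succ i ih =>
      obtain ⟨M, hM0, hM⟩ := ih
      set C : ℝ := H 0 + K * (M * L.toReal) with hC
      have hC0 : H 0 ≤ C := by
        have : 0 ≤ K * (M * L.toReal) := by positivity
        linarith
      refine ⟨max M (2 * C), le_max_of_le_left hM0, fun t ht hti => ?_⟩
      rcases le_or_gt t (i * w) with hle' | hgt
      · exact (hM t ht hle').trans (le_max_left _ _)
      · set τ : ℝ := i * w with hτ
        have hτ0 : 0 ≤ τ := by positivity
        have htiw : t - τ ≤ w := by
          have : ((i + 1 : ℕ) : ℝ) * w = τ + w := by rw [hτ]; push_cast; ring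
          linarith
        -- the maximum of `H` on `[τ, t]`
        have hIccT : Icc τ t ⊆ Ico 0 T := fun s hs => ⟨hτ0.trans hs.1, hs.2.trans_lt ht.2⟩
        obtain ⟨tstar, htstar, hmax⟩ := (isCompact_Icc : IsCompact (Icc τ t)).exists_isMaxOn
          (nonempty_Icc.2 hgt.le) (hcont.mono hIccT)
        set m : ℝ := H tstar with hm
        have hmge : ∀ s ∈ Icc τ t, H s ≤ m := fun s hs => (isMaxOn_iff.1 hmax) s hs
        have hm0 : 0 ≤ m := hH0 tstar (hIccT htstar)
        -- the bound at every `t' ∈ [τ, t]`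
        have hbound : ∀ t' ∈ Icc τ t, H t' ≤ C + m / 2 := by
          intro t' ht'
          have ht'T : t' ∈ Ico 0 T := hIccT ht'
          have hcover : Ioo 0 t' ⊆ Ioc 0 τ ∪ Ioo τ t' := fun s hs =>
            (le_or_gt s τ).elim (fun h => Or.inl ⟨hs.1, h⟩) (fun h => Or.inr ⟨h, hs.2⟩)
          have hIocT : Ioc 0 τ ⊆ Ioo 0 T := fun s hs => ⟨hs.1, hs.2.trans_lt (hgt.trans ht.2)⟩
          have hI : ∫⁻ s in Ioo 0 t', g s * ENNReal.ofReal (H s) ≤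
              ENNReal.ofReal M * L + ENNReal.ofReal m * ε := by
            calc ∫⁻ s in Ioo 0 t', g s * ENNReal.ofReal (H s)
                ≤ ∫⁻ s in Ioc 0 τ ∪ Ioo τ t', g s * ENNReal.ofReal (H s) := lintegral_mono_set hcover
              _ ≤ (∫⁻ s in Ioc 0 τ, g s * ENNReal.ofReal (H s)) +
                    ∫⁻ s in Ioo τ t', g s * ENNReal.ofReal (H s) := lintegral_union_le _ _ _
              _ ≤ (∫⁻ s in Ioc 0 τ, g s * ENNReal.ofReal M) + ∫⁻ s in Ioo τ t', g s * ENNReal.ofReal m := by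
                  gcongr ?_ + ?_
                  · refine setLIntegral_mono' measurableSet_Ioc fun s hs => ?_
                    exact mul_le_mul' le_rfl (ENNReal.ofReal_le_ofReal (hM s (hIocT hs |> fun h => ⟨h.1.le, h.2⟩) hs.2))
                  · refine setLIntegral_mono' measurableSet_Ioo fun s hs => ?_
                    exact mul_le_mul' le_rfl (ENNReal.ofReal_le_ofReal (hmge s ⟨hs.1.le, hs.2.le.trans ht'.2⟩))
              _ = ENNReal.ofReal M * (∫⁻ s in Ioc 0 τ, g s) + ENNReal.ofReal m * ∫⁻ s in Ioo τ t', g s := by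
                  rw [lintegral_mul_const _ hg, lintegral_mul_const _ hg, mul_comm (ENNReal.ofReal M),
                    mul_comm (ENNReal.ofReal m)]
              _ ≤ ENNReal.ofReal M * L + ENNReal.ofReal m * ε := by
                  gcongr
                  · exact lintegral_mono_set hIocT
                  · exact (hshort τ t' hτ0 ht'T.2.le (by linarith [ht'.2])).le
          have hfin : ENNReal.ofReal M * L + ENNReal.ofReal m * ε ≠ ⊤ :=
            ENNReal.add_ne_top.2 ⟨ENNReal.mul_ne_top ENNReal.ofReal_ne_top hLtop,
              ENNReal.mul_ne_top ENNReal.ofReal_ne_top hεtop⟩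
          have h2 : (∫⁻ s in Ioo 0 t', g s * ENNReal.ofReal (H s)).toReal ≤ M * L.toReal + m * ε.toReal := by
            have := ENNReal.toReal_mono hfin hI
            rwa [ENNReal.toReal_add (ENNReal.mul_ne_top ENNReal.ofReal_ne_top hLtop)
              (ENNReal.mul_ne_top ENNReal.ofReal_ne_top hεtop), ENNReal.toReal_mul, ENNReal.toReal_mul,
              ENNReal.toReal_ofReal hM0, ENNReal.toReal_ofReal hm0] at this
          calc H t' ≤ H 0 + K * (∫⁻ s in Ioo 0 t', g s * ENNReal.ofReal (H s)).toReal := hle t' ht'T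
            _ ≤ H 0 + K * (M * L.toReal + m * ε.toReal) := by gcongr
            _ = C + (K * ε.toReal) * m := by rw [hC]; ring
            _ ≤ C + (1 / 2) * m := by gcongr
            _ = C + m / 2 := by ring
        have hm2C : m ≤ 2 * C := by
          have := hbound tstar htstar
          linarith
        calc H t ≤ m := hmge t ⟨hgt.le, le_rfl⟩
          _ ≤ 2 * C := hm2C
          _ ≤ max M (2 * C) := le_max_right _ _
  obtain ⟨M, -, hM⟩ := step N
  refine ⟨M, fun t ht => hM t ht ?_⟩
  have hNw : (N : ℝ) * w = T := by rw [hw]; field_simp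
  linarith [ht.2]

end Summit.NavierStokesRegularity.NavierStokesRegularity.Theorems.OneSectorSerrinExtends
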